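import Literature.NumberTheory.DiophantineGeometry.TateAlgorithmInvarianceProofs
import Literature.NumberTheory.EllipticCurves.QuadraticTwistIntegralModel
import HarnessLib

/-!
# Tate's algorithm is invariant under an unramified quadratic twist

`Proofs` file (theorems only, no definitions, no named facts) in topic
`NumberTheory/EllipticCurves`.

Let `R` be a discrete valuation ring with perfect residue field `k`, `W` a Weierstrass equation
over `R` and `k₀ : R` with `d := 4k₀ + 1 ∈ Rˣ`. The integral twist model `W.twistModel k₀`
(`Literature.NumberTheory.EllipticCurves.QuadraticTwistIntegralModel`: the model
`[a₁, d a₂ + k₀ a₁², d a₃, d² a₄ + 2k₀d a₁a₃, d³ a₆ + k₀ d² a₃²]` of the quadratic twist by `d`) has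
the **same Kodaira symbol** as `W` under the literal implementation
`WeierstrassCurve.kodairaSymbolOfMinimal` of Tate's algorithm (Silverman *ATAEC* IV.9.4):
`kodairaSymbolOfMinimal_twistModel`. This is the discriminant-side content of the classical fact
that the reduction type (Kodaira–Néron type of the special fibre) is unchanged by a twist by an
unramified quadratic character (`d` a unit, `d ≡ 1 (mod 4)` in residue characteristic `2`):
Comalada, *Twists and reduction of an elliptic curve*, J. Number Theory 49 (1994), §2; it is what
makes `N(E^{(d)}) = N(E) d²` for `(d, 4N) = 1` true prime by prime.

## Proof

The same coupling as `kodairaSymbolOfMinimal_smul` (`TateAlgorithmInvarianceProofs`) and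
`kodairaSymbolOfMinimal_map_ringEquiv` (`TateAlgorithmRingEquivProofs`): the run on
`W' = W.twistModel k₀` is compared step by step with the run on `W`; after each normalisation the
twisted model is `Eₖ • (Wₖ.twistModel k₀)` for a `u = 1` change `Eₖ`
(`smul_twistModel_eq_conj_smul`, from the intertwining `(C • W).twistModel k₀ = φC • W.twistModel k₀`
of `QuadraticTwistIntegralModel`), which by the rigidity lemmas (`dvd_r_t_of_step2`,
`dvd_r_s_t_of_step6/7/7b/8/9`) lies in the subgroup under which the next test is invariant; and
the tests of `Wₖ.twistModel k₀` agree with those of `Wₖ`: divisibilities by powers of `π` are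
unchanged because `d` is a unit and the correction terms `k₀ a₁²`, `2k₀d a₁a₃`, `k₀d² a₃²` are
divisible by one more power of `π` than needed at every stage (`dvd_twistModel_*`), while the
step-6 cubic and the quadratics of steps 7–9 have their coefficients multiplied by
`d̄, d̄², d̄³` — except the constant term of the `y`-quadratics, which picks up `k̄₀ d̄² ā₃²`; the
characteristic-free root-count criteria (`a² + 4c`, `b² − 4ac`, cubic discriminant and `p² − 3q`)
are multiplied by powers of the unit `d̄` (using `1 + 4k̄₀ = d̄` for the `y`-quadratics), so the
numbers of distinct roots in `k̄` agree (`distinctRootCount_*_twistModel`).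

## Main results

* `Literature.NumberTheory.EllipticCurves.istarIndexAux_twistModel_eq`,
  `…istarIndex_twistModel_eq` — the `Iₙ*` sub-procedure;
* `WeierstrassCurve.kodairaSymbolOfMinimal_twistModel` — the theorem over a DVR.

## References

* J. H. Silverman, *Advanced Topics in the Arithmetic of Elliptic Curves*, GTM 151 (1994), IV.9.4
  (Tate's algorithm) and Rem. IV.9.5. [SilvermanATAEC1994]
* S. Comalada, *Twists and reduction of an elliptic curve*, J. Number Theory 49 (1994), 45–62.
* J. Tate, *Algorithm for determining the type of a singular fiber in an elliptic pencil*,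
  LNM 476 (1975), §§7–8. [Tate1975]
-/

open Polynomial IsLocalRing

namespace Literature.NumberTheory.EllipticCurves

open Literature.NumberTheory.DiophantineGeometry
  Literature.NumberTheory.DiophantineGeometry.TateAlgorithm WeierstrassCurve

/-! ### Divisibility tests of the twisted model -/

section Divisibility

variable {R : Type*} [CommRing R] {k : R} (W : WeierstrassCurve R)

/-- `c ∣ a₂(W^{tw})` iff `c ∣ a₂(W)`, when `c ∣ a₁²` (`a₂ ↦ d a₂ + k a₁²`, `d` a unit). [folklore] -/
theorem dvd_twistModel_a₂_iff (hd : IsUnit (4 * k + 1)) {c : R} (h1 : c ∣ W.a₁ ^ 2) :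
    c ∣ (W.twistModel k).a₂ ↔ c ∣ W.a₂ := by
  rw [twistModel_a₂, dvd_add_left (dvd_mul_of_dvd_right h1 k), hd.dvd_mul_left]

/-- `c ∣ a₃(W^{tw})` iff `c ∣ a₃(W)` (`a₃ ↦ d a₃`). [folklore] -/
theorem dvd_twistModel_a₃_iff (hd : IsUnit (4 * k + 1)) {c : R} :
    c ∣ (W.twistModel k).a₃ ↔ c ∣ W.a₃ := by
  rw [twistModel_a₃, hd.dvd_mul_left]

/-- `c ∣ a₄(W^{tw})` iff `c ∣ a₄(W)`, when `c ∣ a₁ a₃` (`a₄ ↦ d² a₄ + 2kd a₁a₃`). [folklore] -/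
theorem dvd_twistModel_a₄_iff (hd : IsUnit (4 * k + 1)) {c : R} (h13 : c ∣ W.a₁ * W.a₃) :
    c ∣ (W.twistModel k).a₄ ↔ c ∣ W.a₄ := by
  have e : 2 * k * (4 * k + 1) * W.a₁ * W.a₃ = 2 * k * (4 * k + 1) * (W.a₁ * W.a₃) := by ring
  rw [twistModel_a₄, e, dvd_add_left (dvd_mul_of_dvd_right h13 _), (hd.pow 2).dvd_mul_left]

/-- `c ∣ a₆(W^{tw})` iff `c ∣ a₆(W)`, when `c ∣ a₃²` (`a₆ ↦ d³ a₆ + k d² a₃²`). [folklore] -/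
theorem dvd_twistModel_a₆_iff (hd : IsUnit (4 * k + 1)) {c : R} (h3 : c ∣ W.a₃ ^ 2) :
    c ∣ (W.twistModel k).a₆ ↔ c ∣ W.a₆ := by
  rw [twistModel_a₆, dvd_add_left (dvd_mul_of_dvd_right h3 _), (hd.pow 3).dvd_mul_left]

/-- `c ∣ b₂(W^{tw})` iff `c ∣ b₂(W)` (`b₂ ↦ d b₂`). [folklore] -/
theorem dvd_twistModel_b₂_iff (hd : IsUnit (4 * k + 1)) {c : R} :
    c ∣ (W.twistModel k).b₂ ↔ c ∣ W.b₂ := by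
  rw [twistModel_b₂, hd.dvd_mul_left]

/-- `c ∣ b₆(W^{tw})` iff `c ∣ b₆(W)` (`b₆ ↦ d³ b₆`). [folklore] -/
theorem dvd_twistModel_b₆_iff (hd : IsUnit (4 * k + 1)) {c : R} :
    c ∣ (W.twistModel k).b₆ ↔ c ∣ W.b₆ := by
  rw [twistModel_b₆, (hd.pow 3).dvd_mul_left]

/-- `c ∣ b₈(W^{tw})` iff `c ∣ b₈(W)` (`b₈ ↦ d⁴ b₈`). [folklore] -/
theorem dvd_twistModel_b₈_iff (hd : IsUnit (4 * k + 1)) {c : R} :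
    c ∣ (W.twistModel k).b₈ ↔ c ∣ W.b₈ := by
  rw [twistModel_b₈, (hd.pow 4).dvd_mul_left]

/-- `c ∣ Δ(W^{tw})` iff `c ∣ Δ(W)` (`Δ ↦ d⁶ Δ`). [folklore] -/
theorem dvd_twistModel_Δ_iff (hd : IsUnit (4 * k + 1)) {c : R} :
    c ∣ (W.twistModel k).Δ ↔ c ∣ W.Δ := by
  rw [twistModel_Δ, (hd.pow 6).dvd_mul_left]

/-- If `W' = E • W^{tw}`, `W₁ = C • W`, `W₁' = C' • W'` then `W₁' = (C' E (φC)⁻¹) • W₁^{tw}`,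
`φ = VariableChange.twistMap k` (the coupling bookkeeping). [folklore] -/
theorem smul_twistModel_eq_conj_smul {W W₁ W' W₁' : WeierstrassCurve R}
    {E C C' : VariableChange R} (hrel : W' = E • W.twistModel k) (h₁ : W₁ = C • W)
    (h₁' : W₁' = C' • W') :
    W₁' = (C' * E * (VariableChange.twistMap k C)⁻¹) • W₁.twistModel k := by
  rw [h₁', hrel, h₁, twistModel_smul, mul_smul, mul_smul, inv_smul_smul]

/-- The coupling changes keep `u = 1`. [folklore] -/
theorem twist_conj_u_eq_one {E C C' : VariableChange R} (hC' : C'.u = 1) (hE : E.u = 1)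
    (hC : C.u = 1) : (C' * E * (VariableChange.twistMap k C)⁻¹).u = 1 := by
  simp [VariableChange.mul_def, VariableChange.inv_def, hC', hE, hC]

end Divisibility

/-! ### The auxiliary polynomials of the twisted model -/

section PolyTests

variable {R : Type*} [CommRing R] [IsDomain R] [IsDiscreteValuationRing R] {k : R}

/-- `4 k̄ + 1 ≠ 0` in the residue field when `4k + 1` is a unit. [folklore] -/
theorem four_mul_residue_add_one_ne_zero (hd : IsUnit (4 * k + 1)) :
    4 * residue R k + 1 ≠ 0 := by
  have h := (residue_ne_zero_iff_isUnit _).mpr hd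
  rwa [map_add, map_mul, map_ofNat, map_one] at h

/-- `ord Δ` of the twisted model equals `ord Δ` (`Δ ↦ d⁶ Δ`, `d` a unit). [folklore] -/
theorem addVal_Δ_twistModel_toNat (hd : IsUnit (4 * k + 1)) (W : WeierstrassCurve R) :
    (IsDiscreteValuationRing.addVal R (W.twistModel k).Δ).toNat =
      (IsDiscreteValuationRing.addVal R W.Δ).toNat := by
  rw [twistModel_Δ, IsDiscreteValuationRing.addVal_mul,
    IsDiscreteValuationRing.addVal_eq_zero_iff.mpr (hd.pow 6), zero_add]

/-- Step 6/7 cubic tests for the twisted model of a step-6 normalised `W`: the coefficients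
`a₂,₁, a₄,₂, a₆,₃` become `d̄ a₂,₁, d̄² a₄,₂, d̄³ a₆,₃` (the corrections `k a₁²`, `2kd a₁a₃`,
`k d² a₃²` are divisible by `π², π³, π⁴`), so the discriminant is multiplied by `d̄⁶` and `p² − 3q`
by `d̄²`. Silverman *ATAEC* IV.9.4, Steps 6–7. [cite: SilvermanATAEC1994, IV.9.4 Steps 6–7] -/
theorem distinctRootCount_cubicStep6_twistModel (hd : IsUnit (4 * k + 1)) {W : WeierstrassCurve R}
    (h1 : uniformizer R ∣ W.a₁) (h2 : uniformizer R ∣ W.a₂) (h3 : uniformizer R ^ 2 ∣ W.a₃)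
    (h4 : uniformizer R ^ 2 ∣ W.a₄) (h6 : uniformizer R ^ 3 ∣ W.a₆) :
    (distinctRootCount (cubicStep6 (W.twistModel k)) = 3 ↔ distinctRootCount (cubicStep6 W) = 3) ∧
      (distinctRootCount (cubicStep6 (W.twistModel k)) = 2 ↔
        distinctRootCount (cubicStep6 W) = 2) := by
  have hϖ : Irreducible (uniformizer R) := irreducible_uniformizer
  have hres0 : residue R (uniformizer R) = 0 := residue_uniformizer_eq_zero hϖ
  set ϖ := uniformizer R with hϖdef
  set v := 4 * residue R k + 1 with hv
  have hv0 : v ≠ 0 := four_mul_residue_add_one_ne_zero hd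
  obtain ⟨α, hα⟩ := h1
  obtain ⟨β, hβ⟩ := h2
  obtain ⟨γ, hγ⟩ := h3
  obtain ⟨δ, hδ⟩ := h4
  obtain ⟨ε, hε⟩ := h6
  have c2 : redCoeff (W.twistModel k).a₂ 1 = v * residue R β := by
    have e : (W.twistModel k).a₂ = ϖ * ((4 * k + 1) * β + ϖ * (k * α ^ 2)) := by
      rw [twistModel_a₂, hα, hβ]; ring
    rw [e, redCoeff_uniformizer_mul]
    simp only [map_add, map_mul, map_pow, map_ofNat, map_one, hres0, zero_mul, add_zero, hv]
  have c4 : redCoeff (W.twistModel k).a₄ 2 = v ^ 2 * residue R δ := by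
    have e : (W.twistModel k).a₄ =
        ϖ ^ 2 * ((4 * k + 1) ^ 2 * δ + ϖ * (2 * k * (4 * k + 1) * α * γ)) := by
      rw [twistModel_a₄, hα, hγ, hδ]; ring
    rw [e, redCoeff_uniformizer_pow_mul]
    simp only [map_add, map_mul, map_pow, map_ofNat, map_one, hres0, zero_mul, add_zero, hv]
  have c6 : redCoeff (W.twistModel k).a₆ 3 = v ^ 3 * residue R ε := by
    have e : (W.twistModel k).a₆ =
        ϖ ^ 3 * ((4 * k + 1) ^ 3 * ε + ϖ * (k * (4 * k + 1) ^ 2 * γ ^ 2)) := by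
      rw [twistModel_a₆, hγ, hε]; ring
    rw [e, redCoeff_uniformizer_pow_mul]
    simp only [map_add, map_mul, map_pow, map_ofNat, map_one, hres0, zero_mul, add_zero, hv]
  have w2 : redCoeff W.a₂ 1 = residue R β := by rw [hβ, redCoeff_uniformizer_mul]
  have w4 : redCoeff W.a₄ 2 = residue R δ := by rw [hδ, redCoeff_uniformizer_pow_mul]
  have w6 : redCoeff W.a₆ 3 = residue R ε := by rw [hε, redCoeff_uniformizer_pow_mul]
  set p := residue R β
  set q := residue R δ
  set r := residue R ε
  have hdisc : (v * p) ^ 2 * (v ^ 2 * q) ^ 2 - 4 * (v ^ 2 * q) ^ 3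
      - 4 * (v * p) ^ 3 * (v ^ 3 * r) - 27 * (v ^ 3 * r) ^ 2
      + 18 * (v * p) * (v ^ 2 * q) * (v ^ 3 * r) =
      v ^ 6 * (p ^ 2 * q ^ 2 - 4 * q ^ 3 - 4 * p ^ 3 * r - 27 * r ^ 2 + 18 * p * q * r) := by
    ring
  have hpq : (v * p) ^ 2 - 3 * (v ^ 2 * q) = v ^ 2 * (p ^ 2 - 3 * q) := by ring
  have h3 : distinctRootCount (cubicStep6 (W.twistModel k)) = 3 ↔
      distinctRootCount (cubicStep6 W) = 3 := by
    rw [cubicStep6, cubicStep6, c2, c4, c6, w2, w4, w6, distinctRootCount_cubic_eq_three_iff,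
      distinctRootCount_cubic_eq_three_iff, hdisc, mul_ne_zero_iff, and_iff_right (pow_ne_zero _ hv0)]
  refine ⟨h3, ?_⟩
  by_cases hz : p ^ 2 * q ^ 2 - 4 * q ^ 3 - 4 * p ^ 3 * r - 27 * r ^ 2 + 18 * p * q * r = 0
  · rw [cubicStep6, cubicStep6, c2, c4, c6, w2, w4, w6,
      distinctRootCount_cubic_eq_two_iff _ _ _ (by rw [hdisc, hz, mul_zero]),
      distinctRootCount_cubic_eq_two_iff _ _ _ hz, hpq, mul_ne_zero_iff,
      and_iff_right (pow_ne_zero _ hv0)]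
  · have hW : distinctRootCount (cubicStep6 W) = 3 := by
      rw [cubicStep6, w2, w4, w6, distinctRootCount_cubic_eq_three_iff]; exact hz
    rw [h3.mpr hW, hW]

/-- Step 7 first quadratic of round `m` (and the step-8 quadratic, `m = 0`) for the twisted model:
`a₃,ₘ₊₂ ↦ d̄ a₃,ₘ₊₂`, `a₆,₂ₘ₊₄ ↦ d̄³ a₆,₂ₘ₊₄ + k̄ d̄² a₃,ₘ₊₂²`, so `a² + 4c` is multiplied by
`d̄²(1 + 4k̄) = d̄³` — a unit. (Over `k` the two quadratics need not be affinely equivalent: in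
residue characteristic `2` this is the Artin–Schreier twist `T² + T + k̄`; only the root counts in
`k̄` agree.) Silverman *ATAEC* IV.9.4, Steps 7–9. [cite: SilvermanATAEC1994, IV.9.4 Steps 7–9] -/
theorem distinctRootCount_quadratic₁_twistModel (hd : IsUnit (4 * k + 1)) {W : WeierstrassCurve R}
    {m : ℕ} (h3 : uniformizer R ^ (m + 2) ∣ W.a₃) (h6 : uniformizer R ^ (2 * m + 4) ∣ W.a₆) :
    distinctRootCount (X ^ 2 + C (redCoeff (W.twistModel k).a₃ (m + 2)) * X
        - C (redCoeff (W.twistModel k).a₆ (2 * m + 4))) = 2 ↔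
      distinctRootCount (X ^ 2 + C (redCoeff W.a₃ (m + 2)) * X
        - C (redCoeff W.a₆ (2 * m + 4))) = 2 := by
  set ϖ := uniformizer R with hϖdef
  set v := 4 * residue R k + 1 with hv
  have hv0 : v ≠ 0 := four_mul_residue_add_one_ne_zero hd
  obtain ⟨γ, hγ⟩ := h3
  obtain ⟨ε, hε⟩ := h6
  have c3 : redCoeff (W.twistModel k).a₃ (m + 2) = v * residue R γ := by
    have e : (W.twistModel k).a₃ = ϖ ^ (m + 2) * ((4 * k + 1) * γ) := by
      rw [twistModel_a₃, hγ]; ring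
    rw [e, redCoeff_uniformizer_pow_mul]
    simp only [map_add, map_mul, map_ofNat, map_one, hv]
  have c6 : redCoeff (W.twistModel k).a₆ (2 * m + 4) =
      v ^ 3 * residue R ε + residue R k * v ^ 2 * residue R γ ^ 2 := by
    have e : (W.twistModel k).a₆ =
        ϖ ^ (2 * m + 4) * ((4 * k + 1) ^ 3 * ε + k * (4 * k + 1) ^ 2 * γ ^ 2) := by
      rw [twistModel_a₆, hγ, hε]; ring
    rw [e, redCoeff_uniformizer_pow_mul]
    simp only [map_add, map_mul, map_pow, map_ofNat, map_one, hv]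
  have w3 : redCoeff W.a₃ (m + 2) = residue R γ := by rw [hγ, redCoeff_uniformizer_pow_mul]
  have w6 : redCoeff W.a₆ (2 * m + 4) = residue R ε := by rw [hε, redCoeff_uniformizer_pow_mul]
  have e : (v * residue R γ) ^ 2 + 4 * (v ^ 3 * residue R ε + residue R k * v ^ 2 * residue R γ ^ 2) =
      v ^ 3 * (residue R γ ^ 2 + 4 * residue R ε) := by
    rw [hv]; ring
  rw [c3, c6, w3, w6, distinctRootCount_sq_add_sub_eq_two_iff,
    distinctRootCount_sq_add_sub_eq_two_iff, e, mul_ne_zero_iff, and_iff_right (pow_ne_zero _ hv0)]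

/-- Step 7 second quadratic of round `m` for the twisted model (with `π ∥ a₂`, `π ∣ a₁`,
`π^{m+3} ∣ a₃`): `(a₂,₁, a₄,ₘ₊₃, a₆,₂ₘ₊₅) ↦ (d̄ a₂,₁, d̄² a₄,ₘ₊₃, d̄³ a₆,₂ₘ₊₅)`, so `b² − 4ac` is
multiplied by `d̄⁴`. Silverman *ATAEC* IV.9.4, Step 7. [cite: SilvermanATAEC1994, IV.9.4 Step 7] -/
theorem distinctRootCount_quadratic₂_twistModel (hd : IsUnit (4 * k + 1)) {W : WeierstrassCurve R}
    {m : ℕ} (h1 : uniformizer R ∣ W.a₁) (h2 : uniformizer R ∣ W.a₂)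
    (h2n : ¬ uniformizer R ^ 2 ∣ W.a₂) (h3 : uniformizer R ^ (m + 3) ∣ W.a₃)
    (h4 : uniformizer R ^ (m + 3) ∣ W.a₄) (h6 : uniformizer R ^ (2 * m + 5) ∣ W.a₆) :
    distinctRootCount (C (redCoeff (W.twistModel k).a₂ 1) * X ^ 2
        + C (redCoeff (W.twistModel k).a₄ (m + 3)) * X
        + C (redCoeff (W.twistModel k).a₆ (2 * m + 5))) = 2 ↔
      distinctRootCount (C (redCoeff W.a₂ 1) * X ^ 2 + C (redCoeff W.a₄ (m + 3)) * X
        + C (redCoeff W.a₆ (2 * m + 5))) = 2 := by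
  have hϖ : Irreducible (uniformizer R) := irreducible_uniformizer
  have hres0 : residue R (uniformizer R) = 0 := residue_uniformizer_eq_zero hϖ
  set ϖ := uniformizer R with hϖdef
  set v := 4 * residue R k + 1 with hv
  have hv0 : v ≠ 0 := four_mul_residue_add_one_ne_zero hd
  obtain ⟨α, hα⟩ := h1
  obtain ⟨β, hβ⟩ := h2
  have hβ0 : residue R β ≠ 0 := by
    intro h
    apply h2n
    obtain ⟨β', hβ'⟩ := (dvd_iff_residue_eq_zero hϖ β).mpr h
    exact ⟨β', by rw [hβ, hβ']; ring⟩
  obtain ⟨γ, hγ⟩ := h3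
  obtain ⟨δ, hδ⟩ := h4
  obtain ⟨ε, hε⟩ := h6
  have c2 : redCoeff (W.twistModel k).a₂ 1 = v * residue R β := by
    have e : (W.twistModel k).a₂ = ϖ * ((4 * k + 1) * β + ϖ * (k * α ^ 2)) := by
      rw [twistModel_a₂, hα, hβ]; ring
    rw [e, redCoeff_uniformizer_mul]
    simp only [map_add, map_mul, map_pow, map_ofNat, map_one, hres0, zero_mul, add_zero, hv]
  have c4 : redCoeff (W.twistModel k).a₄ (m + 3) = v ^ 2 * residue R δ := by
    have e : (W.twistModel k).a₄ =
        ϖ ^ (m + 3) * ((4 * k + 1) ^ 2 * δ + ϖ * (2 * k * (4 * k + 1) * α * γ)) := by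
      rw [twistModel_a₄, hα, hγ, hδ]; ring
    rw [e, redCoeff_uniformizer_pow_mul]
    simp only [map_add, map_mul, map_pow, map_ofNat, map_one, hres0, zero_mul, add_zero, hv]
  have c6 : redCoeff (W.twistModel k).a₆ (2 * m + 5) = v ^ 3 * residue R ε := by
    have e : (W.twistModel k).a₆ =
        ϖ ^ (2 * m + 5) * ((4 * k + 1) ^ 3 * ε + ϖ * (k * (4 * k + 1) ^ 2 * γ ^ 2)) := by
      rw [twistModel_a₆, hγ, hε]; ring
    rw [e, redCoeff_uniformizer_pow_mul]
    simp only [map_add, map_mul, map_pow, map_ofNat, map_one, hres0, zero_mul, add_zero, hv]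
  have w2 : redCoeff W.a₂ 1 = residue R β := by rw [hβ, redCoeff_uniformizer_mul]
  have w4 : redCoeff W.a₄ (m + 3) = residue R δ := by rw [hδ, redCoeff_uniformizer_pow_mul]
  have w6 : redCoeff W.a₆ (2 * m + 5) = residue R ε := by rw [hε, redCoeff_uniformizer_pow_mul]
  have e : (v ^ 2 * residue R δ) ^ 2 - 4 * (v * residue R β) * (v ^ 3 * residue R ε) =
      v ^ 4 * (residue R δ ^ 2 - 4 * residue R β * residue R ε) := by ring
  rw [c2, c4, c6, w2, w4, w6,
    distinctRootCount_quadratic_eq_two_iff_ne_zero (mul_ne_zero hv0 hβ0),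
    distinctRootCount_quadratic_eq_two_iff_ne_zero hβ0, e, mul_ne_zero_iff,
    and_iff_right (pow_ne_zero _ hv0)]

/-- Step 8 test for the twisted model (case `m = 0` of
`distinctRootCount_quadratic₁_twistModel`). [cite: SilvermanATAEC1994, IV.9.4 Step 8] -/
theorem distinctRootCount_quadraticStep8_twistModel (hd : IsUnit (4 * k + 1))
    {W : WeierstrassCurve R} (h3 : uniformizer R ^ 2 ∣ W.a₃) (h6 : uniformizer R ^ 4 ∣ W.a₆) :
    distinctRootCount (quadraticStep8 (W.twistModel k)) = 2 ↔
      distinctRootCount (quadraticStep8 W) = 2 := by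
  have h := distinctRootCount_quadratic₁_twistModel hd (W := W) (m := 0) (by simpa using h3)
    (by simpa using h6)
  simpa [quadraticStep8] using h

end PolyTests

/-! ### Coupling the run on `W^{tw}` with the run on `W` -/

section Coupling

variable {R : Type*} [CommRing R] [IsDomain R] [IsDiscreteValuationRing R] {k : R}

omit [IsDomain R] [IsDiscreteValuationRing R] in
/-- `ϖ ^ (2j) ∣ a²` from `ϖ ^ j ∣ a` (bookkeeping). [folklore] -/
theorem pow_two_mul_dvd_sq {ϖ a : R} {j : ℕ} (h : ϖ ^ j ∣ a) : ϖ ^ (2 * j) ∣ a ^ 2 := by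
  have h2 := pow_dvd_pow_of_dvd h 2
  rwa [← pow_mul, mul_comm] at h2

/-- **The `Iₙ*` sub-procedure along the twist** (coupled induction on the fuel): if
`W' = E • W^{tw}` with `E` a `u = 1` change and both `W` and `W'` are normalised for the start of
round `m` (`π ∣ a₁`, `π ∥ a₂`, `π^{m+2} ∣ a₃`, `π^{m+3} ∣ a₄`, `π^{2m+4} ∣ a₆`), then
`istarIndexAux` returns the same value on both. Same coupling as `istarIndexAux_smul_eq` /
`istarIndexAux_map_eq`, the twisted run being compared with the twist `Wₖ^{tw}` of the plain run
(rigidity `dvd_r_s_t_of_step7/7b`, test invariance `distinctRootCount_quadratic₁/₂_smul` and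
`…_twistModel`). Silverman *ATAEC* IV.9.4, Step 7. [cite: SilvermanATAEC1994, IV.9.4 Step 7] -/
theorem istarIndexAux_twistModel_eq [PerfectField (ResidueField R)] (hd : IsUnit (4 * k + 1))
    (fuel : ℕ) :
    ∀ (m : ℕ) {W W' : WeierstrassCurve R} {E : VariableChange R},
      W' = E • W.twistModel k → E.u = 1 →
      uniformizer R ∣ W.a₁ → uniformizer R ∣ W.a₂ → ¬ uniformizer R ^ 2 ∣ W.a₂ →
      uniformizer R ^ (m + 2) ∣ W.a₃ → uniformizer R ^ (m + 3) ∣ W.a₄ →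
      uniformizer R ^ (2 * m + 4) ∣ W.a₆ →
      uniformizer R ∣ W'.a₁ → uniformizer R ∣ W'.a₂ → ¬ uniformizer R ^ 2 ∣ W'.a₂ →
      uniformizer R ^ (m + 2) ∣ W'.a₃ → uniformizer R ^ (m + 3) ∣ W'.a₄ →
      uniformizer R ^ (2 * m + 4) ∣ W'.a₆ →
      istarIndexAux fuel m W' = istarIndexAux fuel m W := by
  classical
  set ϖ := uniformizer R with hϖdef
  induction fuel with
  | zero => intros; rw [istarIndexAux_zero, istarIndexAux_zero]
  | succ fuel ih =>
    intro m W W' E hrel hu h1 h2 h2n h3 h4 h6 h1' h2' h2n' h3' h4' h6'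
    rw [istarIndexAux_succ, istarIndexAux_succ]
    -- the twist of the plain model and rigidity of `E`
    have v1 : ϖ ∣ (W.twistModel k).a₁ := by rw [twistModel_a₁]; exact h1
    have v2 : ϖ ∣ (W.twistModel k).a₂ :=
      (dvd_twistModel_a₂_iff W hd (dvd_pow h1 two_ne_zero)).mpr h2
    have v2n : ¬ ϖ ^ 2 ∣ (W.twistModel k).a₂ := by
      rw [dvd_twistModel_a₂_iff W hd (pow_dvd_pow_of_dvd h1 2)]; exact h2n
    have v3 : ϖ ^ (m + 2) ∣ (W.twistModel k).a₃ := (dvd_twistModel_a₃_iff W hd).mpr h3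
    have h13 : ϖ ^ (m + 3) ∣ W.a₁ * W.a₃ := by rw [pow_succ']; exact mul_dvd_mul h1 h3
    have v4 : ϖ ^ (m + 3) ∣ (W.twistModel k).a₄ := (dvd_twistModel_a₄_iff W hd h13).mpr h4
    have h33 : ϖ ^ (2 * m + 4) ∣ W.a₃ ^ 2 := by
      have h := pow_two_mul_dvd_sq h3
      rwa [show 2 * (m + 2) = 2 * m + 4 by ring] at h
    have v6 : ϖ ^ (2 * m + 4) ∣ (W.twistModel k).a₆ := (dvd_twistModel_a₆_iff W hd h33).mpr h6
    rw [hrel] at h1' h2' h2n' h3' h4' h6'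
    obtain ⟨hr, hs, ht⟩ := dvd_r_s_t_of_step7 hu v1 v2 v2n v3 v4 v6 h1' h2' h3' h4' h6'
    -- first test
    have iffA : distinctRootCount (X ^ 2 + C (redCoeff (E • W.twistModel k).a₃ (m + 2)) * X
        - C (redCoeff (E • W.twistModel k).a₆ (2 * m + 4))) = 2 ↔
        distinctRootCount (X ^ 2 + C (redCoeff W.a₃ (m + 2)) * X
        - C (redCoeff W.a₆ (2 * m + 4))) = 2 := by
      rw [distinctRootCount_quadratic₁_smul hu v1 v2 v3 v4 v6 hr hs ht,
        distinctRootCount_quadratic₁_twistModel hd h3 h6]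
    rw [hrel]
    by_cases hA : distinctRootCount (X ^ 2 + C (redCoeff W.a₃ (m + 2)) * X
        - C (redCoeff W.a₆ (2 * m + 4))) = 2
    · rw [if_pos hA, if_pos (iffA.mpr hA)]
    have hA' := fun h => hA (iffA.mp h)
    rw [if_neg hA, if_neg hA']
    -- the `y`-translations exist on both sides
    have hexA := exists_normalize_istarA h1 h2 h3 h4 h6 hA
    have hexA' := exists_normalize_istarA h1' h2' h3' h4' h6' hA'
    rw [dif_pos hexA, dif_pos hexA']
    simp only []
    obtain ⟨k1, k2, k2n, k3, k4, k6⟩ := istarA_spec h1 h2 h2n h3 h4 h6 hexA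
    obtain ⟨k1', k2', k2n', k3', k4', k6'⟩ := istarA_spec h1' h2' h2n' h3' h4' h6' hexA'
    set W₁ := hexA.choose • W with hW₁
    set W₁' := hexA'.choose • (E • W.twistModel k) with hW₁'
    -- coupling of the translated models
    have hrel₁ : W₁' = (hexA'.choose * E * (VariableChange.twistMap k hexA.choose)⁻¹) •
        W₁.twistModel k := smul_twistModel_eq_conj_smul rfl hW₁ hW₁'
    have hu₁ : (hexA'.choose * E * (VariableChange.twistMap k hexA.choose)⁻¹).u = 1 :=
      twist_conj_u_eq_one hexA'.choose_spec.1 hu hexA.choose_spec.1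
    set E₁ := hexA'.choose * E * (VariableChange.twistMap k hexA.choose)⁻¹ with hE₁
    clear_value W₁ W₁' E₁
    have x1 : ϖ ∣ (W₁.twistModel k).a₁ := by rw [twistModel_a₁]; exact k1
    have x2 : ϖ ∣ (W₁.twistModel k).a₂ :=
      (dvd_twistModel_a₂_iff W₁ hd (dvd_pow k1 two_ne_zero)).mpr k2
    have x2n : ¬ ϖ ^ 2 ∣ (W₁.twistModel k).a₂ := by
      rw [dvd_twistModel_a₂_iff W₁ hd (pow_dvd_pow_of_dvd k1 2)]; exact k2n
    have x3 : ϖ ^ (m + 3) ∣ (W₁.twistModel k).a₃ := (dvd_twistModel_a₃_iff W₁ hd).mpr k3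
    have x4 : ϖ ^ (m + 3) ∣ (W₁.twistModel k).a₄ :=
      (dvd_twistModel_a₄_iff W₁ hd (dvd_mul_of_dvd_right k3 _)).mpr k4
    have k33 : ϖ ^ (2 * m + 5) ∣ W₁.a₃ ^ 2 := by
      have h := pow_two_mul_dvd_sq k3
      exact (pow_dvd_pow ϖ (by omega : 2 * m + 5 ≤ 2 * (m + 3))).trans h
    have x6 : ϖ ^ (2 * m + 5) ∣ (W₁.twistModel k).a₆ := (dvd_twistModel_a₆_iff W₁ hd k33).mpr k6
    rw [hrel₁] at k1' k2' k2n' k3' k4' k6'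
    obtain ⟨hr₁, hs₁, ht₁⟩ := dvd_r_s_t_of_step7b hu₁ x1 x2 x2n x3 x4 x6 k1' k2' k3' k4' k6'
    -- second test
    have iffB : distinctRootCount (C (redCoeff (E₁ • W₁.twistModel k).a₂ 1) * X ^ 2
        + C (redCoeff (E₁ • W₁.twistModel k).a₄ (m + 3)) * X
        + C (redCoeff (E₁ • W₁.twistModel k).a₆ (2 * m + 5))) = 2 ↔
        distinctRootCount (C (redCoeff W₁.a₂ 1) * X ^ 2 + C (redCoeff W₁.a₄ (m + 3)) * X
        + C (redCoeff W₁.a₆ (2 * m + 5))) = 2 := by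
      rw [distinctRootCount_quadratic₂_smul hu₁ x1 x2 x3 x4 x6 hr₁ hs₁ ht₁,
        distinctRootCount_quadratic₂_twistModel hd k1 k2 k2n k3 k4 k6]
    rw [hrel₁]
    by_cases hB : distinctRootCount (C (redCoeff W₁.a₂ 1) * X ^ 2 + C (redCoeff W₁.a₄ (m + 3)) * X
        + C (redCoeff W₁.a₆ (2 * m + 5))) = 2
    · rw [if_pos hB, if_pos (iffB.mpr hB)]
    have hB' := fun h => hB (iffB.mp h)
    rw [if_neg hB, if_neg hB']
    -- the `x`-translations exist on both sides
    have hexB := exists_normalize_istarB k1 k2 k2n k3 k4 k6 hB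
    have hexB' := exists_normalize_istarB k1' k2' k2n' k3' k4' k6' hB'
    rw [dif_pos hexB, dif_pos hexB']
    obtain ⟨j1, j2, j2n, j3, j4, j6⟩ := istarB_spec k1 k2 k2n k3 k4 k6 hexB
    obtain ⟨j1', j2', j2n', j3', j4', j6'⟩ := istarB_spec k1' k2' k2n' k3' k4' k6' hexB'
    have hrel₂ : hexB'.choose • (E₁ • W₁.twistModel k) =
        (hexB'.choose * E₁ * (VariableChange.twistMap k hexB.choose)⁻¹) •
          (hexB.choose • W₁).twistModel k :=
      smul_twistModel_eq_conj_smul rfl rfl rfl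
    exact ih (m + 1) hrel₂ (twist_conj_u_eq_one hexB'.choose_spec.1 hu₁ hexB.choose_spec.1)
      j1 j2 j2n j3 j4 j6 j1' j2' j2n' j3' j4' j6'

/-- **`istarIndex` along the twist**: for a step-6 normalised `W` and a step-6 normalised
`W' = E • W^{tw}` (`E` with `u = 1`) whose cubics have exactly two distinct roots, the initial
`x`-translations exist on both sides (perfect residue field), the translated models satisfy
`π ∥ a₂`, and `istarIndexAux_twistModel_eq` applies with the common fuel `ord Δ`.
Silverman *ATAEC* IV.9.4, Step 7. [cite: SilvermanATAEC1994, IV.9.4 Step 7] -/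
theorem istarIndex_twistModel_eq [PerfectField (ResidueField R)] (hd : IsUnit (4 * k + 1))
    {W W' : WeierstrassCurve R} {E : VariableChange R}
    (hrel : W' = E • W.twistModel k) (hu : E.u = 1)
    (h1 : uniformizer R ∣ W.a₁) (h2 : uniformizer R ∣ W.a₂) (h3 : uniformizer R ^ 2 ∣ W.a₃)
    (h4 : uniformizer R ^ 2 ∣ W.a₄) (h6 : uniformizer R ^ 3 ∣ W.a₆)
    (h1' : uniformizer R ∣ W'.a₁) (h2' : uniformizer R ∣ W'.a₂)
    (h3' : uniformizer R ^ 2 ∣ W'.a₃) (h4' : uniformizer R ^ 2 ∣ W'.a₄)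
    (h6' : uniformizer R ^ 3 ∣ W'.a₆)
    (h7 : distinctRootCount (cubicStep6 W) = 2) (h7' : distinctRootCount (cubicStep6 W') = 2) :
    istarIndex W' = istarIndex W := by
  classical
  set ϖ := uniformizer R with hϖdef
  have hex := exists_variableChange_step7_of_dvd h1 h2 h3 h4 h6 h7
  have hex' := exists_variableChange_step7_of_dvd h1' h2' h3' h4' h6' h7'
  unfold istarIndex
  rw [dif_pos hex, dif_pos hex']
  simp only []
  have hf : (IsDiscreteValuationRing.addVal R W'.Δ).toNat =
      (IsDiscreteValuationRing.addVal R W.Δ).toNat := by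
    rw [hrel, addVal_Δ_smul_toNat, addVal_Δ_twistModel_toNat hd]
  rw [hf]
  -- specs of the translated models
  obtain ⟨huC, m1, m2, m3, m4, m6⟩ := hex.choose_spec
  have k1 := mem_maximalIdeal_iff_dvd.mp m1
  have k2 := mem_maximalIdeal_iff_dvd.mp m2
  have k3 := mem_maximalIdeal_pow_iff_dvd.mp m3
  have k4 := mem_maximalIdeal_pow_iff_dvd.mp m4
  have k6 := mem_maximalIdeal_pow_iff_dvd.mp m6
  obtain ⟨huC', m1', m2', m3', m4', m6'⟩ := hex'.choose_spec
  have k1' := mem_maximalIdeal_iff_dvd.mp m1'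
  have k2' := mem_maximalIdeal_iff_dvd.mp m2'
  have k3' := mem_maximalIdeal_pow_iff_dvd.mp m3'
  have k4' := mem_maximalIdeal_pow_iff_dvd.mp m4'
  have k6' := mem_maximalIdeal_pow_iff_dvd.mp m6'
  have d23 : ϖ ^ 2 ∣ ϖ ^ 3 := pow_dvd_pow _ (by norm_num)
  have d34 : ϖ ^ 3 ∣ ϖ ^ 4 := pow_dvd_pow _ (by norm_num)
  -- `π ∥ a₂` on the translated models
  have k2n : ¬ ϖ ^ 2 ∣ (hex.choose • W).a₂ := by
    obtain ⟨hr, hs, ht⟩ := dvd_r_s_t_of_step6 huC h1 h2 h3 h4 h6 k1 k2 k3 (d23.trans k4)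
      (d34.trans k6)
    refine not_sq_dvd_a₂_of_distinctRootCount_eq_two k4 k6 ?_
    rw [distinctRootCount_cubicStep6_smul huC h1 h2 h3 h4 h6 hr hs ht]; exact h7
  have k2n' : ¬ ϖ ^ 2 ∣ (hex'.choose • W').a₂ := by
    obtain ⟨hr, hs, ht⟩ := dvd_r_s_t_of_step6 huC' h1' h2' h3' h4' h6' k1' k2' k3'
      (d23.trans k4') (d34.trans k6')
    refine not_sq_dvd_a₂_of_distinctRootCount_eq_two k4' k6' ?_
    rw [distinctRootCount_cubicStep6_smul huC' h1' h2' h3' h4' h6' hr hs ht]; exact h7'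
  have hrel₇ : hex'.choose • W' =
      (hex'.choose * E * (VariableChange.twistMap k hex.choose)⁻¹) •
        (hex.choose • W).twistModel k :=
    smul_twistModel_eq_conj_smul hrel rfl rfl
  exact istarIndexAux_twistModel_eq hd _ 0 hrel₇ (twist_conj_u_eq_one huC' hu huC) k1 k2 k2n
    k3 k4 k6 k1' k2' k2n' k3' k4' k6'

end Coupling

end Literature.NumberTheory.EllipticCurves

/-! ### The main theorem over a DVR -/

namespace WeierstrassCurve

open Literature.NumberTheory.DiophantineGeometry.TateAlgorithm Literature.NumberTheory.EllipticCurves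

section DVR

variable {R : Type*} [CommRing R] [IsDomain R] [IsDiscreteValuationRing R] {k : R}

/-- **Tate's algorithm is invariant under an unramified quadratic twist** (perfect residue
field): for `d = 4k + 1 ∈ Rˣ` and any Weierstrass equation `W` over the DVR `R`, the literal
implementation `WeierstrassCurve.kodairaSymbolOfMinimal` of steps 1–10 of Silverman *ATAEC* IV.9.4
returns the same Kodaira symbol on the integral twist model `W.twistModel k` as on `W` (no
minimality or `Δ ≠ 0` hypothesis). Proof: the two runs are coupled step by step; after each
normalisation the twisted model is `Eₖ • Wₖ^{tw}` for a `u = 1` change `Eₖ` lying in the subgroup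
singled out by the rigidity lemmas (`dvd_r_t_of_step2`, `dvd_r_s_t_of_step6/7/7b/8/9`), under
which every test is invariant, while the tests of `Wₖ^{tw}` agree with those of `Wₖ`
(`dvd_twistModel_*`, `distinctRootCount_*_twistModel`). This is the reduction-type half of
Comalada 1994, §2 (the Kodaira type is unchanged by an unramified quadratic twist), for the
tree's implementation of Tate's algorithm. (Dot-notation extension of the Mathlib namespace
`WeierstrassCurve`, as `kodairaSymbolOfMinimal_smul`.) [cite: SilvermanATAEC1994, IV.9.4 (PDF pp. 344–346)] -/
theorem kodairaSymbolOfMinimal_twistModel [PerfectField (IsLocalRing.ResidueField R)]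
    (hd : IsUnit (4 * k + 1)) (W : WeierstrassCurve R) :
    (W.twistModel k).kodairaSymbolOfMinimal = W.kodairaSymbolOfMinimal := by
  classical
  set ϖ := uniformizer R with hϖdef
  unfold kodairaSymbolOfMinimal
  simp only []
  -- Step 1
  have i1 : (W.twistModel k).Δ ∉ maximalIdeal R ↔ W.Δ ∉ maximalIdeal R := by
    rw [mem_maximalIdeal_iff_dvd, mem_maximalIdeal_iff_dvd, dvd_twistModel_Δ_iff W hd]
  by_cases h1 : W.Δ ∉ maximalIdeal R
  · rw [if_pos h1, if_pos (i1.mpr h1)]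
  rw [if_neg h1, if_neg (fun h => h1 (i1.mp h))]
  have hΔ : W.Δ ∈ maximalIdeal R := not_not.mp h1
  have hΔ' : (W.twistModel k).Δ ∈ maximalIdeal R := not_not.mp (fun h => h1 (i1.mp h))
  -- Step 2 normalisations
  have hex2 := exists_variableChange_step2_of_perfectField W hΔ
  have hex2' := exists_variableChange_step2_of_perfectField (W.twistModel k) hΔ'
  have e2 : normalizeStep2 W = hex2.choose • W := by
    unfold normalizeStep2; rw [dif_pos hex2]
  have e2' : normalizeStep2 (W.twistModel k) = hex2'.choose • W.twistModel k := by
    unfold normalizeStep2; rw [dif_pos hex2']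
  rw [e2, e2', addVal_Δ_twistModel_toNat hd W]
  obtain ⟨hu2, p3, p4, p6⟩ := hex2.choose_spec
  have n3 := mem_maximalIdeal_iff_dvd.mp p3
  have n4 := mem_maximalIdeal_iff_dvd.mp p4
  have n6 := mem_maximalIdeal_iff_dvd.mp p6
  obtain ⟨hu2', p3', p4', p6'⟩ := hex2'.choose_spec
  have n3' := mem_maximalIdeal_iff_dvd.mp p3'
  have n4' := mem_maximalIdeal_iff_dvd.mp p4'
  have n6' := mem_maximalIdeal_iff_dvd.mp p6'
  set W₂ := hex2.choose • W with hW₂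
  set W₂' := hex2'.choose • W.twistModel k with hW₂'
  have hrel₂ : W₂' = (hex2'.choose * 1 * (VariableChange.twistMap k hex2.choose)⁻¹) •
      W₂.twistModel k :=
    smul_twistModel_eq_conj_smul (one_smul _ _).symm hW₂ hW₂'
  have hu₂ : (hex2'.choose * 1 * (VariableChange.twistMap k hex2.choose)⁻¹).u = 1 :=
    twist_conj_u_eq_one hu2' rfl hu2
  set E₂ := hex2'.choose * 1 * (VariableChange.twistMap k hex2.choose)⁻¹ with hE₂
  clear_value W₂ W₂' E₂
  have v3 : ϖ ∣ (W₂.twistModel k).a₃ := (dvd_twistModel_a₃_iff W₂ hd).mpr n3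
  have v4 : ϖ ∣ (W₂.twistModel k).a₄ :=
    (dvd_twistModel_a₄_iff W₂ hd (dvd_mul_of_dvd_right n3 _)).mpr n4
  have v6 : ϖ ∣ (W₂.twistModel k).a₆ :=
    (dvd_twistModel_a₆_iff W₂ hd (dvd_pow n3 two_ne_zero)).mpr n6
  have m3' : ϖ ∣ (E₂ • W₂.twistModel k).a₃ := hrel₂ ▸ n3'
  have m4' : ϖ ∣ (E₂ • W₂.twistModel k).a₄ := hrel₂ ▸ n4'
  have m6' : ϖ ∣ (E₂ • W₂.twistModel k).a₆ := hrel₂ ▸ n6'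
  obtain ⟨hr₂, ht₂⟩ := dvd_r_t_of_step2 hu₂ v3 v4 v6 m3' m4' m6'
  -- Step 2 test
  have i2 : W₂'.b₂ ∉ maximalIdeal R ↔ W₂.b₂ ∉ maximalIdeal R := by
    rw [mem_maximalIdeal_iff_dvd, mem_maximalIdeal_iff_dvd, hrel₂, dvd_b₂_smul_iff hu₂ hr₂,
      dvd_twistModel_b₂_iff W₂ hd]
  by_cases h2 : W₂.b₂ ∉ maximalIdeal R
  · rw [if_pos h2, if_pos (i2.mpr h2)]
  rw [if_neg h2, if_neg (fun h => h2 (i2.mp h))]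
  have hb₂ : ϖ ∣ W₂.b₂ := mem_maximalIdeal_iff_dvd.mp (not_not.mp h2)
  have hb₂' : ϖ ∣ W₂'.b₂ := mem_maximalIdeal_iff_dvd.mp (not_not.mp (fun h => h2 (i2.mp h)))
  have vb₂ : ϖ ∣ (W₂.twistModel k).b₂ := (dvd_twistModel_b₂_iff W₂ hd).mpr hb₂
  -- Step 3 test
  have va₃₃ : ϖ ^ 2 ∣ W₂.a₃ ^ 2 := pow_dvd_pow_of_dvd n3 2
  have i3 : W₂'.a₆ ∉ maximalIdeal R ^ 2 ↔ W₂.a₆ ∉ maximalIdeal R ^ 2 := by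
    rw [mem_maximalIdeal_pow_iff_dvd, mem_maximalIdeal_pow_iff_dvd, hrel₂,
      sq_dvd_a₆_smul_iff hu₂ v3 v4 hr₂ ht₂, dvd_twistModel_a₆_iff W₂ hd va₃₃]
  by_cases h3 : W₂.a₆ ∉ maximalIdeal R ^ 2
  · rw [if_pos h3, if_pos (i3.mpr h3)]
  rw [if_neg h3, if_neg (fun h => h3 (i3.mp h))]
  have ha₆ : ϖ ^ 2 ∣ W₂.a₆ := mem_maximalIdeal_pow_iff_dvd.mp (not_not.mp h3)
  have ha₆' : ϖ ^ 2 ∣ W₂'.a₆ :=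
    mem_maximalIdeal_pow_iff_dvd.mp (not_not.mp (fun h => h3 (i3.mp h)))
  have va₆ : ϖ ^ 2 ∣ (W₂.twistModel k).a₆ := (dvd_twistModel_a₆_iff W₂ hd va₃₃).mpr ha₆
  -- Step 4 test
  have i4 : W₂'.b₈ ∉ maximalIdeal R ^ 3 ↔ W₂.b₈ ∉ maximalIdeal R ^ 3 := by
    rw [mem_maximalIdeal_pow_iff_dvd, mem_maximalIdeal_pow_iff_dvd, hrel₂,
      cube_dvd_b₈_smul_iff hu₂ v3 v4 va₆ hr₂, dvd_twistModel_b₈_iff W₂ hd]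
  by_cases h4 : W₂.b₈ ∉ maximalIdeal R ^ 3
  · rw [if_pos h4, if_pos (i4.mpr h4)]
  rw [if_neg h4, if_neg (fun h => h4 (i4.mp h))]
  have hb₈ : ϖ ^ 3 ∣ W₂.b₈ := mem_maximalIdeal_pow_iff_dvd.mp (not_not.mp h4)
  have hb₈' : ϖ ^ 3 ∣ W₂'.b₈ :=
    mem_maximalIdeal_pow_iff_dvd.mp (not_not.mp (fun h => h4 (i4.mp h)))
  have vb₈ : ϖ ^ 3 ∣ (W₂.twistModel k).b₈ := (dvd_twistModel_b₈_iff W₂ hd).mpr hb₈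
  -- Step 5 test
  have i5 : W₂'.b₆ ∉ maximalIdeal R ^ 3 ↔ W₂.b₆ ∉ maximalIdeal R ^ 3 := by
    rw [mem_maximalIdeal_pow_iff_dvd, mem_maximalIdeal_pow_iff_dvd, hrel₂,
      cube_dvd_b₆_smul_iff hu₂ v3 va₆ vb₂ vb₈ hr₂, dvd_twistModel_b₆_iff W₂ hd]
  by_cases h5 : W₂.b₆ ∉ maximalIdeal R ^ 3
  · rw [if_pos h5, if_pos (i5.mpr h5)]
  rw [if_neg h5, if_neg (fun h => h5 (i5.mp h))]
  have hb₆ : ϖ ^ 3 ∣ W₂.b₆ := mem_maximalIdeal_pow_iff_dvd.mp (not_not.mp h5)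
  have hb₆' : ϖ ^ 3 ∣ W₂'.b₆ :=
    mem_maximalIdeal_pow_iff_dvd.mp (not_not.mp (fun h => h5 (i5.mp h)))
  -- Step 6 normalisations
  have hex6 := exists_variableChange_step6_of_dvd n3 n4 ha₆ hb₂ hb₆ hb₈
  have hex6' := exists_variableChange_step6_of_dvd n3' n4' ha₆' hb₂' hb₆' hb₈'
  have e6 : normalizeStep6 W₂ = hex6.choose • W₂ := by
    unfold normalizeStep6; rw [dif_pos hex6]
  have e6' : normalizeStep6 W₂' = hex6'.choose • W₂' := by
    unfold normalizeStep6; rw [dif_pos hex6']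
  rw [e6, e6']
  obtain ⟨hu6, s1, s2, s3, s4, s6⟩ := hex6.choose_spec
  have q1 := mem_maximalIdeal_iff_dvd.mp s1
  have q2 := mem_maximalIdeal_iff_dvd.mp s2
  have q3 := mem_maximalIdeal_pow_iff_dvd.mp s3
  have q4 := mem_maximalIdeal_pow_iff_dvd.mp s4
  have q6 := mem_maximalIdeal_pow_iff_dvd.mp s6
  obtain ⟨hu6', s1', s2', s3', s4', s6'⟩ := hex6'.choose_spec
  have q1' := mem_maximalIdeal_iff_dvd.mp s1'
  have q2' := mem_maximalIdeal_iff_dvd.mp s2'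
  have q3' := mem_maximalIdeal_pow_iff_dvd.mp s3'
  have q4' := mem_maximalIdeal_pow_iff_dvd.mp s4'
  have q6' := mem_maximalIdeal_pow_iff_dvd.mp s6'
  set W₆ := hex6.choose • W₂ with hW₆
  set W₆' := hex6'.choose • W₂' with hW₆'
  have hrel₆ : W₆' = (hex6'.choose * E₂ * (VariableChange.twistMap k hex6.choose)⁻¹) •
      W₆.twistModel k :=
    smul_twistModel_eq_conj_smul hrel₂ hW₆ hW₆'
  have hu₆ : (hex6'.choose * E₂ * (VariableChange.twistMap k hex6.choose)⁻¹).u = 1 :=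
    twist_conj_u_eq_one hu6' hu₂ hu6
  set E₆ := hex6'.choose * E₂ * (VariableChange.twistMap k hex6.choose)⁻¹ with hE₆
  clear_value W₆ W₆' E₆
  have x1 : ϖ ∣ (W₆.twistModel k).a₁ := by rw [twistModel_a₁]; exact q1
  have x2 : ϖ ∣ (W₆.twistModel k).a₂ :=
    (dvd_twistModel_a₂_iff W₆ hd (dvd_pow q1 two_ne_zero)).mpr q2
  have x3 : ϖ ^ 2 ∣ (W₆.twistModel k).a₃ := (dvd_twistModel_a₃_iff W₆ hd).mpr q3
  have x4 : ϖ ^ 2 ∣ (W₆.twistModel k).a₄ :=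
    (dvd_twistModel_a₄_iff W₆ hd (dvd_mul_of_dvd_right q3 _)).mpr q4
  have q33 : ϖ ^ 3 ∣ W₆.a₃ ^ 2 :=
    (pow_dvd_pow ϖ (by norm_num : 3 ≤ 2 * 2)).trans (pow_two_mul_dvd_sq q3)
  have x6 : ϖ ^ 3 ∣ (W₆.twistModel k).a₆ := (dvd_twistModel_a₆_iff W₆ hd q33).mpr q6
  have y1' : ϖ ∣ (E₆ • W₆.twistModel k).a₁ := hrel₆ ▸ q1'
  have y2' : ϖ ∣ (E₆ • W₆.twistModel k).a₂ := hrel₆ ▸ q2'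
  have y3' : ϖ ^ 2 ∣ (E₆ • W₆.twistModel k).a₃ := hrel₆ ▸ q3'
  have y4' : ϖ ^ 2 ∣ (E₆ • W₆.twistModel k).a₄ := hrel₆ ▸ q4'
  have y6' : ϖ ^ 3 ∣ (E₆ • W₆.twistModel k).a₆ := hrel₆ ▸ q6'
  obtain ⟨hr₆, hs₆, ht₆⟩ := dvd_r_s_t_of_step6 hu₆ x1 x2 x3 x4 x6 y1' y2' y3' y4' y6'
  -- Steps 6 and 7 tests
  have c6 : distinctRootCount (cubicStep6 W₆') =
      distinctRootCount (cubicStep6 (W₆.twistModel k)) := by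
    rw [hrel₆, distinctRootCount_cubicStep6_smul hu₆ x1 x2 x3 x4 x6 hr₆ hs₆ ht₆]
  have t67 := distinctRootCount_cubicStep6_twistModel hd q1 q2 q3 q4 q6
  have i6 : distinctRootCount (cubicStep6 W₆') = 3 ↔ distinctRootCount (cubicStep6 W₆) = 3 := by
    rw [c6, t67.1]
  have i7 : distinctRootCount (cubicStep6 W₆') = 2 ↔ distinctRootCount (cubicStep6 W₆) = 2 := by
    rw [c6, t67.2]
  by_cases h6 : distinctRootCount (cubicStep6 W₆) = 3
  · rw [if_pos h6, if_pos (i6.mpr h6)]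
  have h6' : distinctRootCount (cubicStep6 W₆') ≠ 3 := fun h => h6 (i6.mp h)
  rw [if_neg h6, if_neg h6']
  by_cases h7 : distinctRootCount (cubicStep6 W₆) = 2
  · rw [if_pos h7, if_pos (i7.mpr h7),
      istarIndex_twistModel_eq hd hrel₆ hu₆ q1 q2 q3 q4 q6 q1' q2' q3' q4' q6' h7 (i7.mpr h7)]
  have h7' : distinctRootCount (cubicStep6 W₆') ≠ 2 := fun h => h7 (i7.mp h)
  rw [if_neg h7, if_neg h7']
  -- Step 8 normalisations
  have hex8 := exists_variableChange_step8_of_dvd q1 q2 q3 q4 q6 h6 h7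
  have hex8' := exists_variableChange_step8_of_dvd q1' q2' q3' q4' q6' h6' h7'
  have e8 : normalizeStep8 W₆ = hex8.choose • W₆ := by
    unfold normalizeStep8; rw [dif_pos hex8]
  have e8' : normalizeStep8 W₆' = hex8'.choose • W₆' := by
    unfold normalizeStep8; rw [dif_pos hex8']
  rw [e8, e8']
  obtain ⟨hu8, t1, t2, t3, t4, t6⟩ := hex8.choose_spec
  have y1 := mem_maximalIdeal_iff_dvd.mp t1
  have y2 := mem_maximalIdeal_pow_iff_dvd.mp t2
  have y3 := mem_maximalIdeal_pow_iff_dvd.mp t3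
  have y4 := mem_maximalIdeal_pow_iff_dvd.mp t4
  have y6 := mem_maximalIdeal_pow_iff_dvd.mp t6
  obtain ⟨hu8', t1', t2', t3', t4', t6'⟩ := hex8'.choose_spec
  have y1'' := mem_maximalIdeal_iff_dvd.mp t1'
  have y2'' := mem_maximalIdeal_pow_iff_dvd.mp t2'
  have y3'' := mem_maximalIdeal_pow_iff_dvd.mp t3'
  have y4'' := mem_maximalIdeal_pow_iff_dvd.mp t4'
  have y6'' := mem_maximalIdeal_pow_iff_dvd.mp t6'
  set W₈ := hex8.choose • W₆ with hW₈
  set W₈' := hex8'.choose • W₆' with hW₈'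
  have hrel₈ : W₈' = (hex8'.choose * E₆ * (VariableChange.twistMap k hex8.choose)⁻¹) •
      W₈.twistModel k :=
    smul_twistModel_eq_conj_smul hrel₆ hW₈ hW₈'
  have hu₈ : (hex8'.choose * E₆ * (VariableChange.twistMap k hex8.choose)⁻¹).u = 1 :=
    twist_conj_u_eq_one hu8' hu₆ hu8
  set E₈ := hex8'.choose * E₆ * (VariableChange.twistMap k hex8.choose)⁻¹ with hE₈
  clear_value W₈ W₈' E₈
  have hd12 : ϖ ∣ ϖ ^ 2 := dvd_pow_self _ two_ne_zero
  have z1 : ϖ ∣ (W₈.twistModel k).a₁ := by rw [twistModel_a₁]; exact y1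
  have z2 : ϖ ^ 2 ∣ (W₈.twistModel k).a₂ :=
    (dvd_twistModel_a₂_iff W₈ hd (pow_dvd_pow_of_dvd y1 2)).mpr y2
  have z3 : ϖ ^ 2 ∣ (W₈.twistModel k).a₃ := (dvd_twistModel_a₃_iff W₈ hd).mpr y3
  have y13 : ϖ ^ 3 ∣ W₈.a₁ * W₈.a₃ := by rw [pow_succ']; exact mul_dvd_mul y1 y3
  have z4 : ϖ ^ 3 ∣ (W₈.twistModel k).a₄ := (dvd_twistModel_a₄_iff W₈ hd y13).mpr y4
  have z6 : ϖ ^ 4 ∣ (W₈.twistModel k).a₆ :=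
    (dvd_twistModel_a₆_iff W₈ hd (pow_two_mul_dvd_sq y3)).mpr y6
  have z1' : ϖ ∣ (E₈ • W₈.twistModel k).a₁ := hrel₈ ▸ y1''
  have z2' : ϖ ^ 2 ∣ (E₈ • W₈.twistModel k).a₂ := hrel₈ ▸ y2''
  have z3' : ϖ ^ 2 ∣ (E₈ • W₈.twistModel k).a₃ := hrel₈ ▸ y3''
  have z4' : ϖ ^ 3 ∣ (E₈ • W₈.twistModel k).a₄ := hrel₈ ▸ y4''
  have z6' : ϖ ^ 4 ∣ (E₈ • W₈.twistModel k).a₆ := hrel₈ ▸ y6''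
  obtain ⟨hr₈, hs₈, ht₈⟩ := dvd_r_s_t_of_step8 hu₈ z1 z2 z3 z4 z6 z1' z2' z3' z4' z6'
  -- Step 8 test
  have i8 : distinctRootCount (quadraticStep8 W₈') = 2 ↔
      distinctRootCount (quadraticStep8 W₈) = 2 := by
    rw [hrel₈, distinctRootCount_quadraticStep8_smul hu₈ z1 (hd12.trans z2) z3 z4 z6 hr₈ hs₈ ht₈,
      distinctRootCount_quadraticStep8_twistModel hd y3 y6]
  by_cases h8 : distinctRootCount (quadraticStep8 W₈) = 2
  · rw [if_pos h8, if_pos (i8.mpr h8)]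
  have h8' : distinctRootCount (quadraticStep8 W₈') ≠ 2 := fun h => h8 (i8.mp h)
  rw [if_neg h8, if_neg h8']
  -- Step 9 normalisations
  have hex9 := exists_variableChange_step9_of_dvd y1 y2 y3 y4 y6 h8
  have hex9' := exists_variableChange_step9_of_dvd y1'' y2'' y3'' y4'' y6'' h8'
  have e9 : normalizeStep9 W₈ = hex9.choose • W₈ := by
    unfold normalizeStep9; rw [dif_pos hex9]
  have e9' : normalizeStep9 W₈' = hex9'.choose • W₈' := by
    unfold normalizeStep9; rw [dif_pos hex9']
  rw [e9, e9']
  obtain ⟨hu9, o1, o2, o3, o4, o6⟩ := hex9.choose_spec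
  have g1 := mem_maximalIdeal_iff_dvd.mp o1
  have g2 := mem_maximalIdeal_pow_iff_dvd.mp o2
  have g3 := mem_maximalIdeal_pow_iff_dvd.mp o3
  have g4 := mem_maximalIdeal_pow_iff_dvd.mp o4
  have g6 := mem_maximalIdeal_pow_iff_dvd.mp o6
  obtain ⟨hu9', o1', o2', o3', o4', o6'⟩ := hex9'.choose_spec
  have g1' := mem_maximalIdeal_iff_dvd.mp o1'
  have g2' := mem_maximalIdeal_pow_iff_dvd.mp o2'
  have g3' := mem_maximalIdeal_pow_iff_dvd.mp o3'
  have g4' := mem_maximalIdeal_pow_iff_dvd.mp o4'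
  have g6' := mem_maximalIdeal_pow_iff_dvd.mp o6'
  set W₉ := hex9.choose • W₈ with hW₉
  set W₉' := hex9'.choose • W₈' with hW₉'
  have hrel₉ : W₉' = (hex9'.choose * E₈ * (VariableChange.twistMap k hex9.choose)⁻¹) •
      W₉.twistModel k :=
    smul_twistModel_eq_conj_smul hrel₈ hW₉ hW₉'
  have hu₉ : (hex9'.choose * E₈ * (VariableChange.twistMap k hex9.choose)⁻¹).u = 1 :=
    twist_conj_u_eq_one hu9' hu₈ hu9
  set E₉ := hex9'.choose * E₈ * (VariableChange.twistMap k hex9.choose)⁻¹ with hE₉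
  clear_value W₉ W₉' E₉
  have f1 : ϖ ∣ (W₉.twistModel k).a₁ := by rw [twistModel_a₁]; exact g1
  have f2 : ϖ ^ 2 ∣ (W₉.twistModel k).a₂ :=
    (dvd_twistModel_a₂_iff W₉ hd (pow_dvd_pow_of_dvd g1 2)).mpr g2
  have f3 : ϖ ^ 3 ∣ (W₉.twistModel k).a₃ := (dvd_twistModel_a₃_iff W₉ hd).mpr g3
  have g13 : ϖ ^ 4 ∣ W₉.a₁ * W₉.a₃ := by rw [pow_succ']; exact mul_dvd_mul g1 g3
  have f4 : ϖ ^ 3 ∣ (W₉.twistModel k).a₄ :=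
    (dvd_twistModel_a₄_iff W₉ hd ((pow_dvd_pow ϖ (by norm_num : 3 ≤ 4)).trans g13)).mpr g4
  have g33 : ϖ ^ 6 ∣ W₉.a₃ ^ 2 := pow_two_mul_dvd_sq g3
  have f6 : ϖ ^ 5 ∣ (W₉.twistModel k).a₆ :=
    (dvd_twistModel_a₆_iff W₉ hd ((pow_dvd_pow ϖ (by norm_num : 5 ≤ 6)).trans g33)).mpr g6
  have f1' : ϖ ∣ (E₉ • W₉.twistModel k).a₁ := hrel₉ ▸ g1'
  have f2' : ϖ ^ 2 ∣ (E₉ • W₉.twistModel k).a₂ := hrel₉ ▸ g2'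
  have f3' : ϖ ^ 3 ∣ (E₉ • W₉.twistModel k).a₃ := hrel₉ ▸ g3'
  have f4' : ϖ ^ 3 ∣ (E₉ • W₉.twistModel k).a₄ := hrel₉ ▸ g4'
  have f6' : ϖ ^ 5 ∣ (E₉ • W₉.twistModel k).a₆ := hrel₉ ▸ g6'
  obtain ⟨hr₉, hs₉, ht₉⟩ := dvd_r_s_t_of_step9 hu₉ f1 f2 f3 f4 f6 f1' f2' f3' f4' f6'
  -- Step 9 test
  have i9 : W₉'.a₄ ∉ maximalIdeal R ^ 4 ↔ W₉.a₄ ∉ maximalIdeal R ^ 4 := by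
    rw [mem_maximalIdeal_pow_iff_dvd, mem_maximalIdeal_pow_iff_dvd, hrel₉,
      pow_four_dvd_a₄_smul_iff hu₉ f1 f2 f3 hr₉ hs₉ ht₉, dvd_twistModel_a₄_iff W₉ hd g13]
  by_cases h9 : W₉.a₄ ∉ maximalIdeal R ^ 4
  · rw [if_pos h9, if_pos (i9.mpr h9)]
  rw [if_neg h9, if_neg (fun h => h9 (i9.mp h))]
  have ha₄ : ϖ ^ 4 ∣ W₉.a₄ := mem_maximalIdeal_pow_iff_dvd.mp (not_not.mp h9)
  have fa₄ : ϖ ^ 4 ∣ (W₉.twistModel k).a₄ := (dvd_twistModel_a₄_iff W₉ hd g13).mpr ha₄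
  -- Step 10 test
  have i10 : W₉'.a₆ ∉ maximalIdeal R ^ 6 ↔ W₉.a₆ ∉ maximalIdeal R ^ 6 := by
    rw [mem_maximalIdeal_pow_iff_dvd, mem_maximalIdeal_pow_iff_dvd, hrel₉,
      pow_six_dvd_a₆_smul_iff hu₉ f1 f2 f3 fa₄ hr₉ ht₉, dvd_twistModel_a₆_iff W₉ hd g33]
  by_cases h10 : W₉.a₆ ∉ maximalIdeal R ^ 6
  · rw [if_pos h10, if_pos (i10.mpr h10)]
  rw [if_neg h10, if_neg (fun h => h10 (i10.mp h))]

end DVR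

end WeierstrassCurve
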